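import Mathlib
import Summits.ValiantsHypothesis.ValiantsHypothesis.Theorems.NewtonUnitEquationsDissociatedUniformTotalsLawCoOrientedRigid
import Summits.ValiantsHypothesis.ValiantsHypothesis.Theorems.NewtonUnitEquationsDissociatedUniformTotalsLawSharpFibreTotals
import HarnessLib

/-!
# Crux `NewtonUnitEquations.DissociatedUniform` (stmt-ValiantsHypothesis-5905): the co-oriented pointwise law BEYOND rigid pairs —
# pairs with strictly convex fibres AND anti-fibres have every class hull of size `≤ 4q` under any co-oriented convex third polygon

Memo `Cruxes/DissociatedUniform/NOTES-t1g8.md` §5(i) / this seat's `…TotalsLawCoOrientedRigid` (`V_s ≤ 4q` for two sampled circles, via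
the rigid rotation of the fibres).  What the crossing-number argument really uses is not rigidity but ONE LAP of the exposing normals
along a shear orbit: the edge `{x, x+1}` of the fibre `P_{s−u+2x}` has edge vector `Δa(x) − Δb(x + κ)` (`κ = s − u − 1`), which is the
`x`-th edge vector of the ANTI-FIBRE `G_κ : x ↦ a x − b (x + κ)`.  So if all fibres `x ↦ a x + b (r − x)` and all anti-fibres `G_κ` are
strictly convex counter-clockwise polygons — an OPEN stratum of pairs containing the rigid pairs (two sampled circles) and every pair
(strictly convex ccw `a`, sufficiently small `b`) — the exposing normals along each orbit are the normal fan of a convex polygon, which turns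
exactly once (`…TotalsLawOneLap`):

* `card_udir_hits_le_three` — the crossing number for ANY strictly increasing angle sequence of span `< 2π` (not just `t₀ + 2πx/q`);
* `wTop_perp_edgeVec₀/₁` — the outward normal of an edge of a strictly convex ccw polygon exposes its two ends;
* **`card_commonDir_antiFibre_le : #CommonDir ≤ 4q`**, **`classVert_antiFibre_smul_le : ∃ μ₀ ∀ μ ≥ μ₀ ∀ s, V_s(a, b, μ•c) ≤ 4q`**,
  **`totalVert_antiFibre_smul_le : T ≤ 4q²`** for such pairs and ANY strictly convex ccw `c` (`q ≥ 3`), dominant regime.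
Honest label: a pointwise law on an open stratum in the dominant regime; `CoOrientedClassBound` (all co-oriented convexly ordered pairs, all
regimes), `SmoothSharpTotalsLaw`, `TotalsLawThree` remain OPEN; nothing here bears on VP ≠ VNP.
[folklore]
-/

set_option linter.dupNamespace false -- `ValiantsHypothesis.ValiantsHypothesis` (summit = problem) in every name

open scoped BigOperators

namespace Summit.ValiantsHypothesis.ValiantsHypothesis.Theorems.NewtonUnitEquationsDissociatedUniform

namespace TotalsLaw

open Matrix Real

section AntiFibres

variable {q : ℕ} [NeZero q]

open scoped Classical in
/-- **THE CROSSING NUMBER for a monotone angle sequence.**  `c` strictly convex ccw (`q ≥ 3`), `τ : ℕ → ℝ` strictly increasing on `[0, q)`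
with `τ (q−1) < τ 0 + 2π`, `u ∈ ℤ/q`: at most THREE labels `x` have `c (u − 2x)` a weak top at `udir (τ x)`. [folklore] -/
theorem card_udir_hits_le_three {c : ZMod q → (Fin 2 → ℝ)} (hc : StrictlyConvexCcw c) (hq : 3 ≤ q) (τ : ℕ → ℝ)
    (hτ : ∀ i j : ℕ, i < j → j < q → τ i < τ j) (hlap : τ (q - 1) < τ 0 + 2 * π) (u : ZMod q) :
    (Finset.univ.filter fun x : ZMod q => WTop c (udir (τ x.val)) (u - 2 * x)).card ≤ 3 := by
  obtain ⟨ω, hmono, hper, hlift⟩ := exists_coneAngles hc hq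
  have h2π : (0 : ℝ) < 2 * π := by positivity
  -- shift all angles by a multiple of `2π` so that `τ 0` lands in `[ω q, ω q + 2π)`
  set t₀ := toIcoMod h2π (ω q) (τ 0) with ht₀
  have ht₀mem := toIcoMod_mem_Ico h2π (ω q) (τ 0)
  rw [← ht₀] at ht₀mem
  obtain ⟨ht₀lo, ht₀hi⟩ := ht₀mem
  obtain ⟨m, hm⟩ : ∃ m : ℤ, t₀ = τ 0 + m * (2 * π) := by
    refine ⟨-toIcoDiv h2π (ω q) (τ 0), ?_⟩
    have e := self_sub_toIcoMod h2π (ω q) (τ 0)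
    rw [zsmul_eq_mul, ← ht₀] at e
    push_cast; linarith
  set T : ZMod q → ℝ := fun x => τ x.val + m * (2 * π) with hT
  have hTu : ∀ x : ZMod q, udir (T x) = udir (τ x.val) := fun x => udir_add_int_mul _ _
  have hτmono : ∀ x x' : ZMod q, x.val ≤ x'.val → τ x.val ≤ τ x'.val := fun x x' h => by
    rcases h.eq_or_lt with h | h
    · rw [h]
    · exact (hτ _ _ h (ZMod.val_lt x')).le
  have hτ0 : ∀ x : ZMod q, τ 0 ≤ τ x.val := fun x => by
    rcases Nat.eq_zero_or_pos x.val with h | h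
    · rw [h]
    · exact (hτ 0 _ h (ZMod.val_lt x)).le
  have hτq : ∀ x : ZMod q, τ x.val ≤ τ (q - 1) := fun x => by
    have hx := ZMod.val_lt x
    rcases (show x.val ≤ q - 1 by omega).eq_or_lt with h | h
    · rw [h]
    · exact (hτ _ _ h (by omega)).le
  have hTge : ∀ x : ZMod q, ω q ≤ T x := fun x => by simp only [hT]; linarith [hτ0 x]
  have hTlt : ∀ x x' : ZMod q, T x' < T x + 2 * π := fun x x' => by
    simp only [hT]; linarith [hτq x', hτ0 x]
  have hTmono : ∀ x x' : ZMod q, x.val < x'.val → T x < T x' := fun x x' h => by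
    simp only [hT]; linarith [hτ _ _ h (ZMod.val_lt x')]
  -- the hits and their lifts
  set H := Finset.univ.filter fun x : ZMod q => WTop c (udir (τ x.val)) (u - 2 * x) with hH
  have hex : ∀ x, x ∈ H → ∃ i : ℕ, q ≤ i ∧ (i : ZMod q) = u - 2 * x ∧ ω (i - 1) ≤ T x ∧ T x ≤ ω i := by
    intro x hx
    have hw := (Finset.mem_filter.1 hx).2
    rw [← hTu] at hw
    exact hlift (T x) (u - 2 * x) (hTge x) hw
  choose! I hI using hex
  have hD : ∀ x ∈ H, ((I x + 2 * x.val : ℕ) : ZMod q) = u := by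
    intro x hx
    obtain ⟨-, hIx, -, -⟩ := hI x hx
    push_cast; rw [hIx, ZMod.natCast_zmod_val]; ring
  have hcmp : ∀ x ∈ H, ∀ x' ∈ H, x.val < x'.val →
      I x + 2 * x.val < I x' + 2 * x'.val ∧ I x' + 2 * x'.val < I x + 2 * x.val + 3 * q := by
    intro x hx x' hx' hlt
    obtain ⟨hqI, -, hI1, hI2⟩ := hI x hx
    obtain ⟨hqI', -, hI1', hI2'⟩ := hI x' hx'
    have hTT := hTmono x x' hlt
    have h1 : I x - 1 < I x' := by
      have : ω (I x - 1) < ω (I x') := lt_of_le_of_lt hI1 (lt_of_lt_of_le hTT hI2')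
      exact hmono.lt_iff_lt.1 this
    have h2 : I x' - 1 < I x + q := by
      have : ω (I x' - 1) < ω (I x + q) := by
        rw [hper]; exact lt_of_le_of_lt hI1' (lt_of_lt_of_le (hTlt x x') (by linarith))
      exact hmono.lt_iff_lt.1 this
    have hxq : x'.val < q := ZMod.val_lt x'
    constructor <;> omega
  have hinj : Set.InjOn (fun x => ((I x + 2 * x.val) / q) % 3) H := by
    intro x hx x' hx' hxx'
    simp only [Finset.mem_coe] at hx hx'
    by_contra hne
    have hval : x.val ≠ x'.val := fun h => hne (ZMod.val_injective q h)
    have hmod : (I x + 2 * x.val) % q = (I x' + 2 * x'.val) % q := by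
      have := (hD x hx).trans (hD x' hx').symm
      exact (ZMod.natCast_eq_natCast_iff' _ _ _).1 this
    have key : ∀ D D' : ℕ, D % q = D' % q → D < D' → D' < D + 3 * q → (D / q) % 3 ≠ (D' / q) % 3 := by
      intro D D' hm' hlt hlt'
      have e1 := Nat.div_add_mod D q
      have e2 := Nat.div_add_mod D' q
      set A := D / q
      set A' := D' / q
      have hA : A < A' := by
        by_contra hle
        push Not at hle
        have : q * A' ≤ q * A := Nat.mul_le_mul_left q hle
        omega
      have hA' : A' < A + 3 := by
        by_contra hle
        push Not at hle
        have : q * (A + 3) ≤ q * A' := Nat.mul_le_mul_left q hle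
        have : q * (A + 3) = q * A + 3 * q := by ring
        omega
      omega
    rcases lt_or_gt_of_ne hval with hlt | hgt
    · obtain ⟨c1, c2⟩ := hcmp x hx x' hx' hlt
      exact key _ _ hmod c1 c2 hxx'
    · obtain ⟨c1, c2⟩ := hcmp x' hx' x hx hgt
      exact key _ _ hmod.symm c1 c2 hxx'.symm
  have hmaps : ∀ x ∈ H, (fun x => ((I x + 2 * x.val) / q) % 3) x ∈ Finset.range 3 := fun x _ =>
    Finset.mem_range.2 (Nat.mod_lt _ (by norm_num))
  calc H.card ≤ (Finset.range 3).card := Finset.card_le_card_of_injOn _ hmaps hinj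
    _ = 3 := Finset.card_range 3

/-! #### The exposing normal of an edge -/

omit [NeZero q] in
/-- The outward normal of the edge `x → x+1` of a strictly convex ccw polygon exposes `x`. [folklore] -/
theorem wTop_perp_edgeVec₀ {P : ZMod q → (Fin 2 → ℝ)} (hP : StrictlyConvexCcw P) (hq : 3 ≤ q) (x : ZMod q) :
    WTop P (perp (edgeVec P x)) x := by
  have hne : perp (edgeVec P x) ≠ 0 := by
    refine perp_ne_zero fun h => ?_
    have := cross2_edgeVec_pos hP hq (x + 1)
    rw [add_sub_cancel_right, h] at this
    simp [cross2] at this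
  rw [wTop_iff_local hP hq hne]
  refine ⟨?_, ?_⟩
  · rw [perp_dotProduct]; exact (cross2_edgeVec_pos hP hq x).le
  · rw [perp_dotProduct_self]

omit [NeZero q] in
/-- The outward normal of the edge `x → x+1` of a strictly convex ccw polygon exposes `x + 1`. [folklore] -/
theorem wTop_perp_edgeVec₁ {P : ZMod q → (Fin 2 → ℝ)} (hP : StrictlyConvexCcw P) (hq : 3 ≤ q) (x : ZMod q) :
    WTop P (perp (edgeVec P x)) (x + 1) := by
  have hne : perp (edgeVec P x) ≠ 0 := by
    refine perp_ne_zero fun h => ?_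
    have := cross2_edgeVec_pos hP hq (x + 1)
    rw [add_sub_cancel_right, h] at this
    simp [cross2] at this
  rw [wTop_iff_local hP hq hne, add_sub_cancel_right]
  refine ⟨?_, ?_⟩
  · rw [perp_dotProduct_self]
  · rw [perp_dotProduct, cross2_swap]
    have := cross2_edgeVec_pos hP hq (x + 1)
    rw [add_sub_cancel_right] at this
    linarith

/-! #### Pairs with convex fibres and anti-fibres -/

/-- The ANTI-FIBRE over `κ`: `x ↦ a x − b (x + κ)`; its edge vectors `Δa(x) − Δb(x+κ)` are those of the fibre edges along a shear orbit. -/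
def antiFibre (a b : ZMod q → (Fin 2 → ℝ)) (κ : ZMod q) : ZMod q → (Fin 2 → ℝ) := fun x => a x - b (x + κ)

omit [NeZero q] in
/-- **The orbit identity**: the edge vector of the edge `x` of the fibre `P_{s−(u−2x)}` is the edge vector of the edge `x` of the anti-fibre
`G_{s−u−1}`. [folklore] -/
theorem edgeVec_bpt_shear (a b : ZMod q → (Fin 2 → ℝ)) (s u x : ZMod q) :
    edgeVec (bpt a b s (u - 2 * x)) x = edgeVec (antiFibre a b (s - u - 1)) x := by
  simp only [edgeVec, bpt, antiFibre]
  rw [show s - (u - 2 * x) - (x + 1) = x + (s - u - 1) by ring, show s - (u - 2 * x) - x = x + 1 + (s - u - 1) by ring]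
  abel

open scoped Classical in
/-- **`#CommonDir ≤ 4q` for pairs with strictly convex ccw fibres and anti-fibres** and any strictly convex ccw third polygon (`q ≥ 3`).
[folklore] -/
theorem card_commonDir_antiFibre_le (hq : 3 ≤ q) {a b c : ZMod q → (Fin 2 → ℝ)} (hc : StrictlyConvexCcw c) (s : ZMod q)
    (hF : ∀ z, StrictlyConvexCcw (bpt a b s z)) (hG : ∀ κ, StrictlyConvexCcw (antiFibre a b κ)) :
    (Finset.univ.filter fun zx : ZMod q × ZMod q => CommonDir a b c s zx.1 zx.2).card ≤ 4 * q := by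
  have hP : ∀ z, SharpTops (bpt a b s z) := fun z => sharpTops_of_strictlyConvexCcw (hF z) hq
  -- an exposed edge is exposed exactly at (positive multiples of) its outward normal
  have hedge : ∀ z x : ZMod q, EdgeHit a b c s z x ↔ WTop c (perp (edgeVec (bpt a b s z) x)) z := by
    intro z x
    constructor
    · rintro ⟨θ, hθ, hz, h0, h1⟩
      have hn0 : perp (edgeVec (bpt a b s z) x) ≠ 0 := by
        refine perp_ne_zero fun h => ?_
        have := cross2_edgeVec_pos (hF z) hq (x + 1)
        rw [add_sub_cancel_right, h] at this
        simp [cross2] at this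
      have h01 : bpt a b s z (x + 1) ≠ bpt a b s z x := (hF z).succ_ne hq x
      obtain ⟨t, ht, rfl⟩ := exposing_unique ((hP z).shift x) hq (by simpa using h01) hn0 hθ
        (by simpa [wTop_shift_iff] using wTop_perp_edgeVec₀ (hF z) hq x)
        (by simpa [wTop_shift_iff] using wTop_perp_edgeVec₁ (hF z) hq x)
        (by simpa [wTop_shift_iff] using h0) (by simpa [wTop_shift_iff] using h1)
      rwa [wTop_smul_iff c ht] at hz
    · intro hz
      have hn0 : perp (edgeVec (bpt a b s z) x) ≠ 0 := by
        refine perp_ne_zero fun h => ?_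
        have := cross2_edgeVec_pos (hF z) hq (x + 1)
        rw [add_sub_cancel_right, h] at this
        simp [cross2] at this
      exact ⟨_, hn0, hz, wTop_perp_edgeVec₀ (hF z) hq x, wTop_perp_edgeVec₁ (hF z) hq x⟩
  -- shear re-indexing and the orbit identity
  have h1 : (Finset.univ.filter fun zx : ZMod q × ZMod q => EdgeHit a b c s zx.1 zx.2).card =
      (Finset.univ.filter fun ux : ZMod q × ZMod q =>
        WTop c (perp (edgeVec (antiFibre a b (s - ux.1 - 1)) ux.2)) (ux.1 - 2 * ux.2)).card := by
    symm
    refine Finset.card_equiv shear fun ux => ?_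
    simp only [Finset.mem_filter, Finset.mem_univ, true_and, shear, Equiv.coe_fn_mk, hedge, edgeVec_bpt_shear]
  -- per orbit `u`: the normals of the anti-fibre turn once ⇒ at most 3 hits
  have hper_u : ∀ u : ZMod q, (Finset.univ.filter fun x : ZMod q =>
      WTop c (perp (edgeVec (antiFibre a b (s - u - 1)) x)) (u - 2 * x)).card ≤ 3 := by
    intro u
    set G := antiFibre a b (s - u - 1) with hGdef
    have hGc : StrictlyConvexCcw G := hG (s - u - 1)
    -- polar form of the normals of `G` along its angle sequence
    have hne0 : nrm G 0 ≠ 0 := by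
      refine perp_ne_zero fun h => ?_
      have := cross2_edgeVec_pos hGc hq 0
      rw [Nat.cast_zero] at h
      rw [h] at this
      simp [cross2] at this
    obtain ⟨r₀, hr₀, t₀, h0⟩ := exists_polar hne0
    set τ := coneAngle G t₀ with hτ
    have hpol : ∀ x : ZMod q, ∃ r : ℝ, 0 < r ∧ perp (edgeVec G x) = r • udir (τ x.val) := fun x => by
      obtain ⟨r, hr, e⟩ := nrm_eq_smul_udir hGc hq hr₀ h0 x.val
      refine ⟨r, hr, ?_⟩
      rw [← e, nrm, ZMod.natCast_zmod_val]
    have hiff : ∀ x : ZMod q, WTop c (perp (edgeVec G x)) (u - 2 * x) ↔ WTop c (udir (τ x.val)) (u - 2 * x) := fun x => by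
      obtain ⟨r, hr, e⟩ := hpol x
      rw [e, wTop_smul_iff c hr]
    rw [Finset.filter_congr fun x _ => hiff x]
    have hmono := coneAngle_strictMono hGc hq hr₀ h0
    refine card_udir_hits_le_three hc hq τ (fun i j hij _ => hmono hij) ?_ u
    have hq1 : q - 1 < q := by omega
    have := hmono hq1
    rw [coneAngle_lap hGc hq hr₀ h0] at this
    simpa only [hτ] using this
  have h3 : (Finset.univ.filter fun ux : ZMod q × ZMod q =>
      WTop c (perp (edgeVec (antiFibre a b (s - ux.1 - 1)) ux.2)) (ux.1 - 2 * ux.2)).card ≤ 3 * q := by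
    rw [card_filter_prod_eq_sum]
    calc ∑ u : ZMod q, _ ≤ ∑ u : ZMod q, 3 := Finset.sum_le_sum fun u _ => hper_u u
      _ = 3 * q := by rw [Finset.sum_const, Finset.card_univ, ZMod.card, smul_eq_mul, mul_comm]
  calc (Finset.univ.filter fun zx : ZMod q × ZMod q => CommonDir a b c s zx.1 zx.2).card
      ≤ q + (Finset.univ.filter fun zx : ZMod q × ZMod q => EdgeHit a b c s zx.1 zx.2).card := card_commonDir_le_add a b hc hq s hP
    _ ≤ q + 3 * q := by rw [h1]; exact Nat.add_le_add_left h3 q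
    _ = 4 * q := by ring

omit [NeZero q] in
/-- The fibre of a class over the blob `z` is the fibre curve over `s − z`. [folklore] -/
theorem bpt_eq_fibreCurve' (a b : ZMod q → (Fin 2 → ℝ)) (s z : ZMod q) : bpt a b s z = fibreCurve a b (s - z) := rfl

/-- **THE CO-ORIENTED POINTWISE LAW ON THE CONVEX-FIBRE STRATUM** (dominant regime): if all fibres `x ↦ a x + b(r − x)` and all anti-fibres
`x ↦ a x − b(x + κ)` are strictly convex ccw and `c` is ANY strictly convex ccw polygon (`q ≥ 3`), then `∃ μ₀, ∀ μ ≥ μ₀, ∀ s,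
V_s(a, b, μ•c) ≤ 4q`. [folklore] -/
theorem classVert_antiFibre_smul_le (hq : 3 ≤ q) {a b c : ZMod q → (Fin 2 → ℝ)} (hc : StrictlyConvexCcw c)
    (hF : ∀ r, StrictlyConvexCcw (fibreCurve a b r)) (hG : ∀ κ, StrictlyConvexCcw (antiFibre a b κ)) :
    ∃ μ₀ : ℝ, ∀ μ : ℝ, μ₀ ≤ μ → ∀ s : ZMod q, classVert a b (μ • c) s ≤ 4 * q := by
  classical
  have hcls : ∀ s : ZMod q, ∃ μ₀ : ℝ, ∀ μ : ℝ, μ₀ ≤ μ → classVert a b (μ • c) s ≤ 4 * q := by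
    intro s
    obtain ⟨μ₀, hμ₀⟩ := classVert_smul_le_card_commonDir a b c s
    refine ⟨μ₀, fun μ hμ => (hμ₀ μ hμ).trans ?_⟩
    exact card_commonDir_antiFibre_le hq hc s (fun z => by rw [bpt_eq_fibreCurve']; exact hF (s - z)) hG
  choose f hf using hcls
  refine ⟨Finset.univ.sup' Finset.univ_nonempty f, fun μ hμ s => hf s μ ?_⟩
  exact (Finset.le_sup' f (Finset.mem_univ s)).trans hμ

/-- **Totals form**: `T(a, b, μ•c) ≤ 4q²` on the convex-fibre stratum, any strictly convex ccw `c`, `μ ≥ μ₀`. [folklore] -/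
theorem totalVert_antiFibre_smul_le (hq : 3 ≤ q) {a b c : ZMod q → (Fin 2 → ℝ)} (hc : StrictlyConvexCcw c)
    (hF : ∀ r, StrictlyConvexCcw (fibreCurve a b r)) (hG : ∀ κ, StrictlyConvexCcw (antiFibre a b κ)) :
    ∃ μ₀ : ℝ, ∀ μ : ℝ, μ₀ ≤ μ → totalVert a b (μ • c) ≤ 4 * q ^ 2 := by
  obtain ⟨μ₀, hμ₀⟩ := classVert_antiFibre_smul_le hq hc hF hG
  refine ⟨μ₀, fun μ hμ => ?_⟩
  unfold totalVert
  calc ∑ s, classVert a b (μ • c) s ≤ ∑ _s : ZMod q, 4 * q := Finset.sum_le_sum fun s _ => hμ₀ μ hμ s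
    _ = 4 * q ^ 2 := by rw [Finset.sum_const, Finset.card_univ, ZMod.card, smul_eq_mul]; ring

end AntiFibres

end TotalsLaw

end Summit.ValiantsHypothesis.ValiantsHypothesis.Theorems.NewtonUnitEquationsDissociatedUniform
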